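import Mathlib
import Summits.ValiantsHypothesis.ValiantsHypothesis.Theorems.KPlusLogSqLawLiftingFiniteBaseDominance
import Summits.ValiantsHypothesis.ValiantsHypothesis.Theorems.KPlusLogSqLawLiftingLocalDescartesOneSided

/-!
# Patchworking at finite base, chord margins (part 1): monomial masses at REAL points — ratio monotonicity, the chord
(geometric-mean) bound, and the transition points of a window

HONEST FRAMING.  Helper file toward the lifting crux `WeakLifting` (stmt-ValiantsHypothesis-19561; aside `Lifting`
stmt-ValiantsHypothesis-19772, registered stub `stub_liftThin`) of route `KPlusLogSqLaw` (cell `pub-symmetroid`, seat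
val-sym-lift-p1 g9, 2026-08-27).  Elementary inequalities for monomial masses `C·x^e` at real points `x > 0`, and their instances for
the Leibniz terms of the patchworked pencil of a tropical design; bookkeeping for part 2 (`…LiftingFiniteBaseChordMargin`), which proves
that a window of a near-tropical pencil carries EXACTLY its tropical count even in the presence of hidden slopes, provided the hidden terms
lie below the CHORD of the window by a margin.  Nothing here asserts `WeakLifting`, `TropicalB`, Conjecture B, `MatrixDescartes`
(stmt-ValiantsHypothesis-18050) or anything about VP ≠ VNP.

CONTENT.
* `mass_le_of_le_at_of_exp_le` / `mass_le_of_le_at_of_exp_ge` — RATIO MONOTONICITY: a monomial of smaller (larger) exponent that is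
  beaten by the factor `η` at `x₀` stays beaten on `[x₀, ∞)` (on `(0, x₀]`).
* `mass_le_max_of_chord` — the CHORD BOUND: if `C_q^{i+j} ≤ (η C₁)^i (η C₂)^j` then the monomial `C_q x^{e₁+j}` is at most
  `η · max(C₁ x^{e₁}, C₂ x^{e₁+i+j})` at EVERY `x > 0` (weighted geometric mean ≤ max; this is «`q` lies `log_b(1/η)` below the chord of the
  edge `(e₁, e₁+i+j)` of the Newton polygon»).
* `exists_transition_point` — for `C₁, C₂ > 0`, `n ≥ 1` and a ratio `ρ > 0` there is `p > 0` with `C₂ p^{e+n} = ρ · C₁ p^e`;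
  `lt_of_ratio_lt` — the ratio `C₂ x^{e+n} / (C₁ x^e)` is strictly increasing, so points are ordered by their ratios.
* design instances (`termMass`-free spelling `b^{−V(q)} x^{D(q)}`): `mass_le_of_margin_low` / `mass_le_of_margin_high` (a term of slope
  `≤ D(P)` / `≥ D(P)` beaten with margin `M` at the integer slope `θ` where `P` dominates stays beaten by `b^{−M}` to the right / left of
  `b^θ`), `mass_le_max_of_chordMargin` (a hidden term below the chord of `(P, P')` by `M` — the integer inequality
  `V(P)(D(P')−D(q)) + V(P')(D(q)−D(P)) + M(D(P')−D(P)) ≤ V(q)(D(P')−D(P))` — is at most `b^{−M} max` of the two edge terms everywhere).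
No `def`.  [folklore]
-/

set_option linter.dupNamespace false
set_option autoImplicit false

namespace Summit.ValiantsHypothesis.ValiantsHypothesis.Theorems.KPlusLogSqLaw.LocalDescartes

open Polynomial Finset
open scoped BigOperators
open Summit.ValiantsHypothesis.ValiantsHypothesis.Theorems.MatrixDescartes.Negative
  (patchMatrix tropWeight termSign)

variable {m K : ℕ}

/-! ## Monomial masses at real points -/

/-- **Ratio monotonicity (smaller exponent).**  If `e ≤ e'` and `C x₀^e ≤ η · C' x₀^{e'}` at some `x₀ > 0` (`C ≥ 0`), then
`C x^e ≤ η · C' x^{e'}` for every `x ≥ x₀`. [folklore] -/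
theorem mass_le_of_le_at_of_exp_le {C C' η x₀ x : ℝ} (hC : 0 ≤ C) {e e' : ℕ} (he : e ≤ e')
    (hx₀ : 0 < x₀) (hx : x₀ ≤ x) (h : C * x₀ ^ e ≤ η * (C' * x₀ ^ e')) : C * x ^ e ≤ η * (C' * x ^ e') := by
  have hxpos : 0 < x := lt_of_lt_of_le hx₀ hx
  have hηC' : 0 ≤ η * C' := by
    have h1 : 0 ≤ (η * C') * x₀ ^ e' := by
      have h2 : η * (C' * x₀ ^ e') = (η * C') * x₀ ^ e' := by ring
      rw [← h2]; exact le_trans (mul_nonneg hC (pow_nonneg hx₀.le _)) h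
    rcases le_or_gt 0 (η * C') with h' | h'
    · exact h'
    · exact absurd h1 (not_le.mpr (mul_neg_of_neg_of_pos h' (pow_pos hx₀ _)))
  -- `x₀^{e'} x^{e} ≤ x^{e'} x₀^{e}`
  have hpm := pow_mul_pow_le_of_le hx₀ hx he
  -- multiply the hypothesis by `x^e` and compare
  have key : (C * x ^ e) * x₀ ^ e' ≤ (η * (C' * x ^ e')) * x₀ ^ e' := by
    have h1 : (C * x ^ e) * x₀ ^ e' = (C * x₀ ^ e) * x ^ e * x₀ ^ (e' - e) := by
      obtain ⟨t, rfl⟩ := Nat.exists_eq_add_of_le he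
      rw [Nat.add_sub_cancel_left, pow_add]; ring
    calc (C * x ^ e) * x₀ ^ e' = (C * x₀ ^ e) * (x ^ e * x₀ ^ (e' - e)) := by rw [h1]; ring
      _ ≤ (η * (C' * x₀ ^ e')) * (x ^ e * x₀ ^ (e' - e)) :=
          mul_le_mul_of_nonneg_right h (mul_nonneg (pow_nonneg hxpos.le _) (pow_nonneg hx₀.le _))
      _ = (η * C') * (x₀ ^ e' * x ^ e) * x₀ ^ (e' - e) := by ring
      _ ≤ (η * C') * (x ^ e' * x₀ ^ e) * x₀ ^ (e' - e) :=
          mul_le_mul_of_nonneg_right (mul_le_mul_of_nonneg_left hpm hηC') (pow_nonneg hx₀.le _)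
      _ = (η * (C' * x ^ e')) * x₀ ^ e' := by
          obtain ⟨t, rfl⟩ := Nat.exists_eq_add_of_le he
          rw [Nat.add_sub_cancel_left, pow_add]; ring
  exact le_of_mul_le_mul_right key (pow_pos hx₀ _)

/-- **Ratio monotonicity (larger exponent).**  If `e' ≤ e` and `C x₀^e ≤ η · C' x₀^{e'}` at some `x₀ > 0` (`C ≥ 0`), then
`C x^e ≤ η · C' x^{e'}` for every `0 < x ≤ x₀`. [folklore] -/
theorem mass_le_of_le_at_of_exp_ge {C C' η x₀ x : ℝ} (hC : 0 ≤ C) {e e' : ℕ} (he : e' ≤ e)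
    (hx0 : 0 < x) (hx : x ≤ x₀) (h : C * x₀ ^ e ≤ η * (C' * x₀ ^ e')) : C * x ^ e ≤ η * (C' * x ^ e') := by
  have hx₀ : 0 < x₀ := lt_of_lt_of_le hx0 hx
  have hηC' : 0 ≤ η * C' := by
    have h1 : 0 ≤ (η * C') * x₀ ^ e' := by
      have : η * (C' * x₀ ^ e') = (η * C') * x₀ ^ e' := by ring
      rw [← this]; exact le_trans (mul_nonneg hC (pow_nonneg hx₀.le _)) h
    rcases le_or_gt 0 (η * C') with h' | h'
    · exact h'
    · exact absurd h1 (not_le.mpr (mul_neg_of_neg_of_pos h' (pow_pos hx₀ _)))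
  -- `x^{e} x₀^{e'} ≤ x₀^{e} x^{e'}`
  have hpm := pow_mul_pow_le_of_le hx0 hx he
  have key : (C * x ^ e) * x₀ ^ e ≤ (η * (C' * x ^ e')) * x₀ ^ e := by
    calc (C * x ^ e) * x₀ ^ e = (C * x₀ ^ e) * x ^ e := by ring
      _ ≤ (η * (C' * x₀ ^ e')) * x ^ e := mul_le_mul_of_nonneg_right h (pow_nonneg hx0.le _)
      _ = (η * C') * (x ^ e * x₀ ^ e') := by ring
      _ ≤ (η * C') * (x₀ ^ e * x ^ e') := mul_le_mul_of_nonneg_left hpm hηC'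
      _ = (η * (C' * x ^ e')) * x₀ ^ e := by ring
  exact le_of_mul_le_mul_right key (pow_pos hx₀ _)

/-- **The chord (geometric-mean) bound.**  Let `C₁, C₂ ≥ 0`, `η ≥ 0` and `i + j ≥ 1`: if
`C_q^{i+j} ≤ (η C₁)^i (η C₂)^j` then for every `x > 0` the monomial `C_q x^{e+j}` is at most `η · max(C₁ x^e, C₂ x^{e+i+j})`: a term
lying below the chord of the edge `(e, e+i+j)` by the factor `η` is below the edge's envelope by `η` everywhere. [folklore] -/
theorem mass_le_max_of_chord {C₁ C₂ Cq η x : ℝ} (hC₁ : 0 ≤ C₁) (hC₂ : 0 ≤ C₂) (hη : 0 ≤ η) (hx : 0 < x)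
    {e i j : ℕ} (hij : i + j ≠ 0) (h : Cq ^ (i + j) ≤ (η * C₁) ^ i * (η * C₂) ^ j) :
    Cq * x ^ (e + j) ≤ η * max (C₁ * x ^ e) (C₂ * x ^ (e + (i + j))) := by
  set A := η * (C₁ * x ^ e) with hA
  set B := η * (C₂ * x ^ (e + (i + j))) with hB
  have hA0 : 0 ≤ A := mul_nonneg hη (mul_nonneg hC₁ (pow_nonneg hx.le _))
  have hB0 : 0 ≤ B := mul_nonneg hη (mul_nonneg hC₂ (pow_nonneg hx.le _))
  set Mx := max A B with hMx
  have hMx0 : 0 ≤ Mx := le_trans hA0 (le_max_left _ _)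
  -- `(Cq x^{e+j})^{i+j} = Cq^{i+j} · x^{(e+j)(i+j)} ≤ (ηC₁)^i (ηC₂)^j x^{(e+j)(i+j)} = A^i B^j`
  have hpow : (Cq * x ^ (e + j)) ^ (i + j) ≤ A ^ i * B ^ j := by
    have h1 : (Cq * x ^ (e + j)) ^ (i + j) = Cq ^ (i + j) * x ^ ((e + j) * (i + j)) := by
      rw [mul_pow, ← pow_mul]
    have h2 : A ^ i * B ^ j = ((η * C₁) ^ i * (η * C₂) ^ j) * x ^ ((e + j) * (i + j)) := by
      have hsplit : (e + j) * (i + j) = e * i + (e + (i + j)) * j := by ring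
      rw [hsplit, pow_add, pow_mul, pow_mul, hA, hB]
      ring
    rw [h1, h2]
    exact mul_le_mul_of_nonneg_right h (pow_nonneg hx.le _)
  have hAB : A ^ i * B ^ j ≤ Mx ^ (i + j) := by
    rw [pow_add]
    exact mul_le_mul (pow_le_pow_left₀ hA0 (le_max_left _ _) i) (pow_le_pow_left₀ hB0 (le_max_right _ _) j)
      (pow_nonneg hB0 _) (pow_nonneg hMx0 _)
  have hle : (Cq * x ^ (e + j)) ^ (i + j) ≤ Mx ^ (i + j) := hpow.trans hAB
  have hres : Cq * x ^ (e + j) ≤ Mx := le_of_pow_le_pow_left₀ hij hMx0 hle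
  -- `max (ηa) (ηb) = η max a b`
  have hmax : Mx = η * max (C₁ * x ^ e) (C₂ * x ^ (e + (i + j))) := by
    rw [hMx, hA, hB, mul_max_of_nonneg _ _ hη]
  rw [← hmax]
  exact hres

/-- **Transition points.**  For `C₁, C₂ > 0`, `n ≥ 1` and a target ratio `ρ > 0` there is `p > 0` with `C₂ p^{e+n} = ρ · C₁ p^e`
(namely `p = (ρ C₁/C₂)^{1/n}`). [folklore] -/
theorem exists_transition_point {C₁ C₂ ρ : ℝ} (hC₁ : 0 < C₁) (hC₂ : 0 < C₂) (hρ : 0 < ρ) (e : ℕ) {n : ℕ} (hn : n ≠ 0) :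
    ∃ p : ℝ, 0 < p ∧ C₂ * p ^ (e + n) = ρ * (C₁ * p ^ e) := by
  set c := ρ * C₁ / C₂ with hc
  have hc0 : 0 < c := div_pos (mul_pos hρ hC₁) hC₂
  refine ⟨c ^ ((n : ℝ)⁻¹), Real.rpow_pos_of_pos hc0 _, ?_⟩
  have hpn : (c ^ ((n : ℝ)⁻¹)) ^ n = c := Real.rpow_inv_natCast_pow hc0.le hn
  rw [pow_add, hpn, hc]
  field_simp

/-- **Points are ordered by their ratios**: for `C₁, C₂ > 0`, `n ≥ 1`, if `C₂ x^{e+n} ≤ ρ C₁ x^e`, `C₂ y^{e+n} = ρ' C₁ y^e` and `ρ < ρ'`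
(`x, y > 0`), then `x < y`. [folklore] -/
theorem lt_of_ratio_lt {C₁ C₂ ρ ρ' x y : ℝ} (hC₁ : 0 < C₁) (hC₂ : 0 < C₂) (hx : 0 < x) (hy : 0 < y) (e : ℕ) {n : ℕ}
    (hxρ : C₂ * x ^ (e + n) ≤ ρ * (C₁ * x ^ e)) (hyρ : C₂ * y ^ (e + n) = ρ' * (C₁ * y ^ e)) (hρ : ρ < ρ') :
    x < y := by
  by_contra hcon
  push Not at hcon
  -- `y ≤ x` ⇒ `y^n ≤ x^n` ⇒ `ρ' = C₂ y^n / C₁ ≤ C₂ x^n / C₁ ≤ ρ`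
  have hyn : y ^ n ≤ x ^ n := pow_le_pow_left₀ hy.le hcon n
  have h1 : C₂ * y ^ n = ρ' * C₁ := by
    have h := hyρ
    rw [pow_add] at h
    have : C₂ * (y ^ e * y ^ n) = (C₂ * y ^ n) * y ^ e := by ring
    rw [this] at h
    have : ρ' * (C₁ * y ^ e) = (ρ' * C₁) * y ^ e := by ring
    rw [this] at h
    exact mul_right_cancel₀ (pow_ne_zero _ hy.ne') h
  have h2 : C₂ * x ^ n ≤ ρ * C₁ := by
    have h := hxρ
    rw [pow_add] at h
    have e1 : C₂ * (x ^ e * x ^ n) = (C₂ * x ^ n) * x ^ e := by ring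
    have e2 : ρ * (C₁ * x ^ e) = (ρ * C₁) * x ^ e := by ring
    rw [e1, e2] at h
    exact le_of_mul_le_mul_right h (pow_pos hx _)
  have h3 : ρ' * C₁ ≤ ρ * C₁ := by
    calc ρ' * C₁ = C₂ * y ^ n := h1.symm
      _ ≤ C₂ * x ^ n := mul_le_mul_of_nonneg_left hyn hC₂.le
      _ ≤ ρ * C₁ := h2
  have : ρ' ≤ ρ := le_of_mul_le_mul_right h3 hC₁
  exact absurd hρ (not_lt.mpr this)

/-! ## Instances for the Leibniz terms of a patchworked pencil -/

/-- **A term of slope `≤ D(P)`, beaten with margin `M` at the integer slope `θ` where `P` dominates, stays beaten by `b^{−M}` at every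
`x ≥ b^θ`.** [folklore] -/
theorem mass_le_of_margin_low (b : ℝ) (hb : 1 < b) (d : Fin K → ℕ) (v : Fin m → Fin m → Fin K → ℤ) (θ : ℤ) (M : ℕ)
    (P q : Equiv.Perm (Fin m) × (Fin m → Fin K)) (hD : (∑ i, d (q.2 i)) ≤ ∑ i, d (P.2 i))
    (hmar : tropWeight d v θ q + M ≤ tropWeight d v θ P) {x : ℝ} (hx : b ^ θ ≤ x) :
    b ^ (-(∑ i, v (q.1 i) i (q.2 i))) * x ^ (∑ i, d (q.2 i))
      ≤ (b ^ (M : ℤ))⁻¹ * (b ^ (-(∑ i, v (P.1 i) i (P.2 i))) * x ^ (∑ i, d (P.2 i))) := by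
  have hb0 : 0 < b := lt_trans one_pos hb
  refine mass_le_of_le_at_of_exp_le (zpow_pos hb0 _).le hD (zpow_pos hb0 θ) hx ?_
  rw [zpow_neg_mul_zpow_pow_eq b hb0 d v θ q, zpow_neg_mul_zpow_pow_eq b hb0 d v θ P, ← zpow_neg, ← zpow_add₀ hb0.ne']
  exact zpow_le_zpow_right₀ hb.le (by linarith)

/-- **A term of slope `≥ D(P)`, beaten with margin `M` at the integer slope `θ` where `P` dominates, stays beaten by `b^{−M}` at every
`0 < x ≤ b^θ`.** [folklore] -/
theorem mass_le_of_margin_high (b : ℝ) (hb : 1 < b) (d : Fin K → ℕ) (v : Fin m → Fin m → Fin K → ℤ) (θ : ℤ) (M : ℕ)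
    (P q : Equiv.Perm (Fin m) × (Fin m → Fin K)) (hD : (∑ i, d (P.2 i)) ≤ ∑ i, d (q.2 i))
    (hmar : tropWeight d v θ q + M ≤ tropWeight d v θ P) {x : ℝ} (hx0 : 0 < x) (hx : x ≤ b ^ θ) :
    b ^ (-(∑ i, v (q.1 i) i (q.2 i))) * x ^ (∑ i, d (q.2 i))
      ≤ (b ^ (M : ℤ))⁻¹ * (b ^ (-(∑ i, v (P.1 i) i (P.2 i))) * x ^ (∑ i, d (P.2 i))) := by
  have hb0 : 0 < b := lt_trans one_pos hb
  refine mass_le_of_le_at_of_exp_ge (zpow_pos hb0 _).le hD hx0 hx ?_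
  rw [zpow_neg_mul_zpow_pow_eq b hb0 d v θ q, zpow_neg_mul_zpow_pow_eq b hb0 d v θ P, ← zpow_neg, ← zpow_add₀ hb0.ne']
  exact zpow_le_zpow_right₀ hb.le (by linarith)

/-- **A hidden term below the CHORD of the edge `(P, P')` by the margin `M`** — slopes `D(P) < D(q) < D(P')` written as
`D(q) = D(P) + j`, `D(P') = D(P) + j + i`, and the integer inequality `V(P)·i + V(P')·j + M·(i+j) ≤ V(q)·(i+j)` — is at most
`b^{−M} · max` of the two edge terms at EVERY `x > 0`. [folklore] -/
theorem mass_le_max_of_chordMargin (b : ℝ) (hb : 1 < b) (d : Fin K → ℕ) (v : Fin m → Fin m → Fin K → ℤ) (M : ℕ)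
    (P P' q : Equiv.Perm (Fin m) × (Fin m → Fin K)) {i j : ℕ} (hij : i + j ≠ 0)
    (hDq : (∑ l, d (q.2 l)) = (∑ l, d (P.2 l)) + j) (hDP' : (∑ l, d (P'.2 l)) = (∑ l, d (P.2 l)) + (i + j))
    (hchord : (∑ l, v (P.1 l) l (P.2 l)) * (i : ℤ) + (∑ l, v (P'.1 l) l (P'.2 l)) * (j : ℤ) + (M : ℤ) * ((i : ℤ) + j)
      ≤ (∑ l, v (q.1 l) l (q.2 l)) * ((i : ℤ) + j))
    {x : ℝ} (hx : 0 < x) :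
    b ^ (-(∑ l, v (q.1 l) l (q.2 l))) * x ^ (∑ l, d (q.2 l))
      ≤ (b ^ (M : ℤ))⁻¹ * max (b ^ (-(∑ l, v (P.1 l) l (P.2 l))) * x ^ (∑ l, d (P.2 l)))
          (b ^ (-(∑ l, v (P'.1 l) l (P'.2 l))) * x ^ (∑ l, d (P'.2 l))) := by
  have hb0 : 0 < b := lt_trans one_pos hb
  set Vq := ∑ l, v (q.1 l) l (q.2 l) with hVq
  set V1 := ∑ l, v (P.1 l) l (P.2 l) with hV1
  set V2 := ∑ l, v (P'.1 l) l (P'.2 l) with hV2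
  rw [hDq, hDP']
  refine mass_le_max_of_chord (zpow_pos hb0 _).le (zpow_pos hb0 _).le (inv_pos.mpr (zpow_pos hb0 _)).le hx hij ?_
  -- exponent bookkeeping: `b^{−Vq (i+j)} ≤ b^{−M(i+j) − V1 i − V2 j}`
  have hpw : ∀ (z : ℤ) (n : ℕ), (b ^ z) ^ n = b ^ (z * (n : ℤ)) := fun z n => by
    rw [← zpow_natCast, ← zpow_mul]
  have hη : (b ^ (M : ℤ))⁻¹ = b ^ (-(M : ℤ)) := (zpow_neg b (M : ℤ)).symm
  rw [hη, ← zpow_add₀ hb0.ne', ← zpow_add₀ hb0.ne', hpw, hpw, hpw, ← zpow_add₀ hb0.ne']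
  refine zpow_le_zpow_right₀ hb.le ?_
  push_cast
  nlinarith [hchord]

end Summit.ValiantsHypothesis.ValiantsHypothesis.Theorems.KPlusLogSqLaw.LocalDescartes
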